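import Literature.Probability.RandomPlanarGeometry.SLEMarkovKernelTransport
import Literature.Probability.RandomPlanarGeometry.SLETraceStrongMarkov
import HarnessLib

/-!
# The domain-Markov kernel of chordal SLE_κ: the test functional of the freezing formula

Topic `Probability/RandomPlanarGeometry`; theorems and definitions (companion of
`SLEMarkovKernelReadOff.lean`, crux `stmt-CriticalPhenomena-0698`, stub `stub_isDomainMarkov`).

* `slePast κ τ ω` — the past datum `(W^τ, τ) ∈ C(ℝ≥0, ℝ) × [0, ∞]` of the freezing formula;
* `pastX φ x` — the stopped class read off a past datum `x = (W, r)` (through `psiTilde`), equal to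
  the class of the stopped curve for generated drivers (`pastX_eq_mk_stoppedCurve`);
* `markovFz φ S T x γ'` — the bounded, jointly measurable test functional
  `𝟙[pastX x ∈ S ∧ compactifiedClass (psiTilde Φp x.1 r) b γ' ∈ T]` (`measurable_uncurry_markovFz`);
* driver locality `pastX_congr`, `psiTilde_congr_driver`; `psiTilde_eq_config_ψ`
  (`psiTilde` of a generated driver is the parametrisation `ψ` of its configuration).

References: W. Werner (2007), §3.2; G. F. Lawler (2005), §6.2–6.3.
-/

noncomputable section

open Set Filter Topology MeasureTheory ProbabilityTheory Complex
open UpperHalfPlane (upperHalfPlaneSet isOpen_upperHalfPlaneSet)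
open scoped NNReal ENNReal unitInterval

namespace Literature.Probability.RandomPlanarGeometry

/-! ### The past datum of the freezing formula (`SLETraceHittingMarkov`) -/

section PastDatum

open scoped PathBorel

/-- The stopped SLE driving path at the hitting time `τ`, bundled as a continuous path, together
with `τ`: the "past" of the freezing formula
`setIntegral_sleTraceAfter_hitting_eq_setIntegral_integral_continuousMap`. [folklore] -/
def slePast (κ : ℝ≥0) (τ : (ℝ≥0 → ℝ) → WithTop ℝ≥0) (ω : ℝ≥0 → ℝ) : C(ℝ≥0, ℝ) × WithTop ℝ≥0 :=
  (⟨fun u ↦ sleDriving κ ω (min u ((τ ω).untopD 0)),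
    (continuous_sleDriving κ ω).comp (continuous_id.min continuous_const)⟩, τ ω)

end PastDatum

/-! ### The `markov` clause on the canonical space: setup -/

section MarkovSetup

open scoped PathBorel

variable {κ : ℝ≥0} {D : DobrushinDomain} {φ : ConformalEquiv upperHalfPlaneSet D.carrier}

/-- Hitting times only see the path. [folklore] -/
theorem hittingAfter_eq_of_path_eq {Ω Ω' : Type*} {u : ℝ≥0 → Ω → ℂ} {v : ℝ≥0 → Ω' → ℂ}
    {ω : Ω} {ω' : Ω'} (h : ∀ t, u t ω = v t ω') (A : Set ℂ) :
    hittingAfter u A 0 ω = hittingAfter v A 0 ω' := by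
  classical
  unfold hittingAfter
  simp only [h]

/-- A described class is the full curve of its describing driver. [folklore] -/
theorem eq_mk_fullCurve_of_isLoewnerDescribed (hφ : D.IsChordalUniformizing φ) {c : CurveClass ℂ}
    {W : ℝ≥0 → ℝ} {γ : ℝ≥0 → ℂ} (hγ : Loewner.IsGeneratedByCurve W γ) {c' : Curve ℂ}
    (hc : c = CurveClass.mk c') (himg : IsCompactifiedImage φ.boundaryExtension γ (D.pt 1) c')
    (htr : Tendsto (fun t ↦ ‖γ t‖) atTop atTop) :
    c = CurveClass.mk (fullCurve hφ hγ htr) :=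
  hc.trans (congrArg CurveClass.mk (himg.unique (isCompactifiedImage_fullCurve hφ hγ htr)))

/-- **`psiTilde` of a generated driver is the parametrisation `ψ` of its configuration.** [folklore] -/
theorem psiTilde_eq_config_ψ (hφ : D.IsChordalUniformizing φ) {W : ℝ≥0 → ℝ} (hW : Continuous W)
    {γ : ℝ≥0 → ℂ} (hγ : Loewner.IsGeneratedByCurve W γ) (r : ℝ≥0) (w : ℂ) :
    psiTilde (Φp φ) (⟨W, hW⟩ : C(ℝ≥0, ℝ)) r w = (mkConfig hφ hW hγ r).ψ w := by
  have hΦpc : ContinuousOn (Φp φ) {z : ℂ | 0 ≤ z.im} := (continuous_Φp φ).continuousOn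
  rw [psiTilde_eq_of_isGeneratedByCurve hΦpc (W := (⟨W, hW⟩ : C(ℝ≥0, ℝ))) hγ r w]
  change Φp φ _ = (mkConfig hφ hW hγ r).Φ (Loewner.bdryInv W r (projH w + (W r : ℂ)))
  rw [Φp_eq_of_im_nonneg φ]
  · rfl
  · exact (mkConfig hφ hW hγ r).bdryInv_im_nonneg ((mkConfig hφ hW hγ r).projH_add_im_nonneg w)

/-- `psiTilde` at the origin reads the image of the trace: `Φp (γ s)`. [folklore] -/
theorem psiTilde_zero_eq (hφ : D.IsChordalUniformizing φ) {W : ℝ≥0 → ℝ} (hW : Continuous W)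
    {γ : ℝ≥0 → ℂ} (hγ : Loewner.IsGeneratedByCurve W γ) (s : ℝ≥0) :
    psiTilde (Φp φ) (⟨W, hW⟩ : C(ℝ≥0, ℝ)) s 0 = φ.boundaryExtension (γ s) := by
  rw [psiTilde_eq_config_ψ hφ hW hγ s 0, SLEConfig.ψ_zero]
  change φ.boundaryExtension ((mkConfig hφ hW hγ s).γ s) = _
  rw [mkConfig_γ]

/-- **The stopped past read off the continuous-path datum.** [folklore] -/
def pastX (φ : ConformalEquiv upperHalfPlaneSet D.carrier) (x : C(ℝ≥0, ℝ) × WithTop ℝ≥0) :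
    CurveClass ℂ :=
  compactifiedClass id (psiTilde (Φp φ) x.1 (x.2.untopD 0) 0)
    fun t ↦ psiTilde (Φp φ) x.1 (x.2.untopD 0 * (t / (1 + t))) 0

/-- For a generated driver (continuous path), `pastX` at the datum `(W, r)` is the class of the
stopped curve at `r`. [folklore] -/
theorem pastX_eq_mk_stoppedCurve (hφ : D.IsChordalUniformizing φ) {W : ℝ≥0 → ℝ} (hW : Continuous W)
    {γ : ℝ≥0 → ℂ} (hγ : Loewner.IsGeneratedByCurve W γ) (r : ℝ≥0) :
    pastX φ ((⟨W, hW⟩ : C(ℝ≥0, ℝ)), (r : WithTop ℝ≥0)) = CurveClass.mk (stoppedCurve φ hγ r) := by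
  unfold pastX
  simp only [WithTop.untopD_coe]
  simp only [psiTilde_zero_eq hφ hW hγ]
  refine IsCompactifiedImage.compactifiedClass_eq ⟨fun u hu ↦ ?_, ?_⟩
  · rw [stoppedCurve_apply]
    simp only [id]
    congr 3
    apply NNReal.eq
    rw [Real.coe_toNNReal _ u.2.1]
    push_cast
    rw [rayParam_div_one_add u hu]
  · rw [stoppedCurve_apply]
    simp

end MarkovSetup

/-! ### The `markov` clause: the test functional of the freezing formula -/

section MarkovFunctional

open scoped PathBorel

variable {κ : ℝ≥0} {D : DobrushinDomain} {φ : ConformalEquiv upperHalfPlaneSet D.carrier}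

/-- **The test functional of the freezing formula** for the `markov` clause: the indicator that
the read-off past is in `S` and the image of the future path under the frozen parametrisation
`psiTilde Φp W r` (endpoint `b`) is in `T`. [cite: Werner2007, §3.2] -/
def markovFz (φ : ConformalEquiv upperHalfPlaneSet D.carrier) (S T : Set (CurveClass ℂ))
    (x : C(ℝ≥0, ℝ) × WithTop ℝ≥0) (γ' : ℝ≥0 → ℂ) : ℝ :=
  (S ×ˢ T).indicator (fun _ ↦ (1 : ℝ))
    (pastX φ x, compactifiedClass (psiTilde (Φp φ) x.1 (x.2.untopD 0)) (D.pt 1) γ')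

/-- The test functional is bounded by `1`. [folklore] -/
theorem abs_markovFz_le_one (S T : Set (CurveClass ℂ)) (x : C(ℝ≥0, ℝ) × WithTop ℝ≥0)
    (γ' : ℝ≥0 → ℂ) : |markovFz φ S T x γ'| ≤ 1 := by
  classical
  unfold markovFz
  rw [indicator_apply]
  split_ifs <;> simp

/-- `psiTilde Φp` read at `(x.1, x.2.untopD 0)` is jointly measurable. [folklore] -/
theorem measurable_psiTilde_untopD (φ : ConformalEquiv upperHalfPlaneSet D.carrier) :
    Measurable (Function.uncurry fun (x : C(ℝ≥0, ℝ) × WithTop ℝ≥0) (w : ℂ) ↦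
      psiTilde (Φp φ) x.1 (x.2.untopD 0) w) := by
  have hM : Measurable fun p : (C(ℝ≥0, ℝ) × ℝ≥0) × ℂ ↦ psiTilde (Φp φ) p.1.1 p.1.2 p.2 :=
    measurable_psiTilde (continuous_Φp φ).measurable
  have hg : Measurable fun q : (C(ℝ≥0, ℝ) × WithTop ℝ≥0) × ℂ ↦ ((q.1.1, q.1.2.untopD 0), q.2) :=
    ((measurable_fst.comp measurable_fst).prodMk
      ((measurable_snd.comp measurable_fst).untopD _)).prodMk measurable_snd
  exact (hM.comp hg :)

/-- The read-off past `pastX` is measurable. [folklore] -/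
theorem measurable_pastX (φ : ConformalEquiv upperHalfPlaneSet D.carrier) : Measurable (pastX φ) := by
  have hM : Measurable fun p : (C(ℝ≥0, ℝ) × ℝ≥0) × ℂ ↦ psiTilde (Φp φ) p.1.1 p.1.2 p.2 :=
    measurable_psiTilde (continuous_Φp φ).measurable
  have hr : Measurable fun x : C(ℝ≥0, ℝ) × WithTop ℝ≥0 ↦ x.2.untopD 0 := measurable_snd.untopD _
  unfold pastX
  refine measurable_compactifiedClass₃ (Ψ := fun _ ↦ id) ?_ ?_ ?_
  · exact measurable_snd
  · have hg : Measurable fun x : C(ℝ≥0, ℝ) × WithTop ℝ≥0 ↦ ((x.1, x.2.untopD 0), (0 : ℂ)) :=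
      (measurable_fst.prodMk hr).prodMk measurable_const
    exact (hM.comp hg :)
  · refine measurable_pi_lambda _ fun t ↦ ?_
    have hg : Measurable fun x : C(ℝ≥0, ℝ) × WithTop ℝ≥0 ↦
        ((x.1, x.2.untopD 0 * (t / (1 + t))), (0 : ℂ)) :=
      (measurable_fst.prodMk (hr.mul_const _)).prodMk measurable_const
    exact (hM.comp hg :)

/-- **The test functional is jointly measurable.** [folklore] -/
theorem measurable_uncurry_markovFz {S T : Set (CurveClass ℂ)} (hS : MeasurableSet S)
    (hT : MeasurableSet T) : Measurable (Function.uncurry (markovFz φ S T)) := by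
  have hpair : Measurable fun p : (C(ℝ≥0, ℝ) × WithTop ℝ≥0) × (ℝ≥0 → ℂ) ↦
      (pastX φ p.1, compactifiedClass (psiTilde (Φp φ) p.1.1 (p.1.2.untopD 0)) (D.pt 1) p.2) :=
    ((measurable_pastX φ).comp measurable_fst).prodMk
      (measurable_compactifiedClass₃
        (Ψ := fun p : (C(ℝ≥0, ℝ) × WithTop ℝ≥0) × (ℝ≥0 → ℂ) ↦ psiTilde (Φp φ) p.1.1 (p.1.2.untopD 0))
        ((measurable_psiTilde_untopD φ).comp
          ((measurable_fst.comp measurable_fst).prodMk measurable_snd) :)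
        measurable_const measurable_snd)
  exact (measurable_const.indicator (hS.prod hT)).comp hpair

/-! #### Driver locality of the read-off data -/

/-- `pastX` only sees the driver up to the time datum. [folklore] -/
theorem pastX_congr {U V : C(ℝ≥0, ℝ)} {r : ℝ≥0} (h : ∀ s, s ≤ r → U s = V s) :
    pastX φ (U, (r : WithTop ℝ≥0)) = pastX φ (V, (r : WithTop ℝ≥0)) := by
  unfold pastX
  simp only [WithTop.untopD_coe]
  have h1 : ∀ t : ℝ≥0, psiTilde (Φp φ) U (r * (t / (1 + t))) 0 =
      psiTilde (Φp φ) V (r * (t / (1 + t))) 0 := by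
    intro t
    have hle : r * (t / (1 + t)) ≤ r :=
      mul_le_of_le_one_right (by positivity) (div_le_one_of_le₀ le_add_self (by positivity))
    exact psiTilde_eq_of_eqOn (W := V) (U := U) (fun s hs ↦ (h s (hs.trans hle)).symm) 0
  have h2 : psiTilde (Φp φ) U r 0 = psiTilde (Φp φ) V r 0 :=
    psiTilde_eq_of_eqOn (W := V) (U := U) (fun s hs ↦ (h s hs).symm) 0
  rw [h2]
  simp only [h1]

/-- `psiTilde` only sees the driver up to the time datum (function form). [folklore] -/
theorem psiTilde_congr_driver {U V : C(ℝ≥0, ℝ)} {r : ℝ≥0} (h : ∀ s, s ≤ r → U s = V s) :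
    psiTilde (Φp φ) U r = psiTilde (Φp φ) V r :=
  funext fun w ↦ psiTilde_eq_of_eqOn (W := V) (U := U) (fun s hs ↦ (h s hs).symm) w

end MarkovFunctional

end Literature.Probability.RandomPlanarGeometry

end
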